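import Mathlib

/-!
# Hodge-locus census, V3-XT `N = 1`: the GENUS LAW refining T-0@3 — finite-field core

HONEST FRAMING: certified instances and evidence bearing on the general Hodge conjecture; no claim.

Setting and notation as in `HodgeLocusCensusValJ0At3` (abs-1 gen 24): `v₃(D) = 1`, `M = |D|/3`,
`B = (-1,-3)_ℚ ⊃ O = ℤ⟨1, i, (1+j)/2, (i+k)/2⟩ = End(E₀)`, `O₃ = O ⊗ ℤ₃ = ℤ₃[i] + ℤ₃[i]·j` the maximal
order of the division algebra `B₃`, uniformiser `Π = j` (`j z = z̄ j` for `z ∈ ℤ₃[i]`), residue field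
`O₃/Π O₃ = 𝔽₉ = 𝔽₃(i)` on which conjugation by `j` acts as Frobenius `x ↦ x³ = x̄`.
For `E` with CM by `O_D` and the image `Y ∈ O` of `√D` (after identifying `E mod 𝔓` with `E₀`),
`v_Π(Y) = 1`, so `z := Y j⁻¹ ∈ O₃^×`; put `z₀ := z mod Π ∈ 𝔽₉^×`.  From `Y² = D`:
`z·σ(z) = M`, hence `N(z₀) = z₀⁴ ≡ M (mod 3)`.  The law T-0@3 (`v' ≥ 9 ⟺ 3 ∣ b ∧ 3 ∣ d ⟺
Y ∈ ℤ₃ j + Π² O₃`, see `mem_three_O_iff` below and `nine_le_vLaw0` / `vLaw0_eq_six` of the first file)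
reads:  `v'(j(E)) ≥ 9 ⟺ z₀ ∈ 𝔽₃^×`,  `v'(j(E)) = 6 ⟺ z₀ ∉ 𝔽₃`.
GALOIS ACTION: for an `O_D`-ideal `𝔞` prime to `3f`, `E' = 𝔞 ∗ E`, the isogeny `E → E'` reduces to
`w ∈ O` with `Nrd w = N𝔞 ∈ ℤ₃^×` and `Y' = w Y w⁻¹`, so `z' = w z σ(w)⁻¹` and `z₀' = z₀ · w₀⁻²`.
SQUARE CASE: for `D = -3f²` (`3 ∤ f`), `E = E₀/C` and `Y = f · u j u⁻¹` with `u ∈ O`, `Nrd u = f`,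
so `z₀ = f · α₀⁻²`, `α₀ = u mod Π`, `N(α₀) ≡ f (mod 3)`.
(derivation: `code/abs_engineA/xt/n1t03/DERIVATION-T03-A.md` §2(f); inputs Deuring reduction and
[cite: GrossZagier1985SingularModuli, §2–3] as in the first file; nothing of this paragraph is formalised.)

GENUS LAW (consequence; the finite-field steps are the theorems of THIS FILE, by `decide` on an explicit
model of `𝔽₉`):
* `M ≡ 2 (mod 3)`: `N(z₀) = -1`, so `z₀ ∉ 𝔽₃` and `v' = 6` at every prime (`nrm_two_not_inF3`; census
  5556/5556 `D ≤ 10⁵`) — a second route to corollary (i) of the first file;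
* `M ≡ 1 (mod 3)`: `z₀ ∈ μ₄ = {±1, ±i}` and the type flips under `𝔞` exactly when `N𝔞 ≡ 2 (mod 3)`
  (`flip_rule`): the sign `ε(E) = z₀²` satisfies `ε(𝔞 ∗ E) = χ₃(𝔞) ε(E)` with `χ₃(𝔞) = (N𝔞 | 3)` the genus
  character at `3`.  `χ₃` is trivial on `Pic(O_D)` iff `M` is a square (i.e. `D₀ = -3`): otherwise exactly
  `h(D)/2` classes have `v' = 6` (`half_of_nontrivial_character`; census: 5434/5434 `D ≤ 10⁵`, 0 exceptions);
* `D = -3f²`, `3 ∤ f`: `v' ≥ 9` at every prime iff `α₀` is a square iff `N(α₀) = 1` iff `f ≡ 1 (mod 3)`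
  (`square_case`); `f ≡ 2 (mod 3)` ⇒ `v' = 6` at every prime and `v₃(H_D(0)) = 3 h(D)` (census: the 121
  such `D ≤ 10⁵` split 61 (`f ≡ 2`: all classes 6) + 60 (`f ≡ 1`: no class 6), 0 exceptions;
  `data/abs/xt/n1t03/GENUS-LAW-T03.json`, two implementations of the law = census on all 11111 `D`).
-/

namespace Summit.HodgeConjecture.HodgeConjecture.HodgeLocus.Census.ValJ0At3Genus

/-- `𝔽₉ = 𝔽₃(i)` as pairs `(x, y) ↔ x + y i`, `i² = -1`. -/
abbrev F9 := ZMod 3 × ZMod 3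

/-- Multiplication in `𝔽₃(i)`. -/
def mul9 (u v : F9) : F9 := (u.1 * v.1 - u.2 * v.2, u.1 * v.2 + u.2 * v.1)

/-- Frobenius `x ↦ x³` = complex conjugation = conjugation by the uniformiser `j`. -/
def frob (u : F9) : F9 := (u.1, -u.2)

/-- The norm `N(x + yi) = x² + y² ∈ 𝔽₃` (reduction of `Nrd` on `ℤ₃[i]^× · (1 + Π O₃) = O₃^×`). -/
def nrm (u : F9) : ZMod 3 := u.1 ^ 2 + u.2 ^ 2

/-- Frobenius is cubing. -/
theorem frob_eq_cube : ∀ u : F9, frob u = mul9 u (mul9 u u) := by decide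

/-- `N(u) = u · ū` (as an element of the prime field). -/
theorem nrm_eq_mul_frob : ∀ u : F9, ((nrm u, 0) : F9) = mul9 u (frob u) := by decide

/-- `N(u) = u⁴`. -/
theorem nrm_eq_pow_four : ∀ u : F9, ((nrm u, 0) : F9) = mul9 (mul9 u u) (mul9 u u) := by decide

/-- A unit of `𝔽₉` has norm `1` or `-1 = 2`. -/
theorem nrm_one_or_two : ∀ u : F9, u ≠ 0 → (nrm u = 1 ∨ nrm u = 2) := by decide

/-- `u` is a square in `𝔽₉^×` iff `N(u) = 1` (the squares are `μ₄ = {±1, ±i}`). -/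
theorem isSquare_iff_nrm_one : ∀ u : F9, u ≠ 0 → ((∃ w : F9, mul9 w w = u) ↔ nrm u = 1) := by decide

/-- `u² ∈ 𝔽₃` iff `N(u) = 1` (used in the square case: `Y ≡ α₀² j (mod 3 O₃)`). -/
theorem sq_inF3_iff_nrm_one : ∀ u : F9, u ≠ 0 → ((mul9 u u).2 = 0 ↔ nrm u = 1) := by decide

/-- `M ≡ 2 (mod 3)`: `N(z₀) = -1` forces `z₀ ∉ 𝔽₃`, i.e. `v'(j(E)) = 6` at every prime over `3`
(second route to corollary (i) of T-0@3; census 5556/5556). -/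
theorem nrm_two_not_inF3 : ∀ z : F9, nrm z = 2 → z.2 ≠ 0 := by decide

/-- `M ≡ 1 (mod 3)`: `N(z₀) = 1` means `z₀ ∈ μ₄`; the type is `v' ≥ 9` iff `z₀ ∈ {±1}` iff `z₀² = 1`,
`v' = 6` iff `z₀ ∈ {±i}` iff `z₀² = -1`. -/
theorem type_of_nrm_one : ∀ z : F9, nrm z = 1 →
    ((z.2 = 0 ↔ mul9 z z = (1, 0)) ∧ (z.2 ≠ 0 ↔ mul9 z z = (-1, 0))) := by decide

/-- FLIP RULE under the Galois action: if `z₀' · w₀² = z₀` with `N(z₀) = 1`, then `z₀' ∈ 𝔽₃` iff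
(`z₀ ∈ 𝔽₃` iff `N(w₀) = 1`); i.e. the type flips exactly when `N𝔞 ≡ N(w₀) = 2 (mod 3)`. -/
theorem flip_rule : ∀ z z' w : F9, w ≠ 0 → nrm z = 1 → mul9 z' (mul9 w w) = z →
    (z'.2 = 0 ↔ (z.2 = 0 ↔ nrm w = 1)) := by decide

/-- SQUARE CASE `D = -3f²`: if `z₀ · α₀² = f` with `f ∈ 𝔽₃^×`, then `z₀ ∈ 𝔽₃` iff `N(α₀) = 1`
(and `N(α₀) ≡ Nrd u = f (mod 3)`): `v' ≥ 9` everywhere iff `f ≡ 1 (mod 3)`. -/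
theorem square_case : ∀ z a : F9, ∀ f : ZMod 3, a ≠ 0 → f ≠ 0 → mul9 z (mul9 a a) = (f, 0) →
    (z.2 = 0 ↔ nrm a = 1) := by decide

/-- … in that situation `N(z₀) = 1` automatically (the square case sits in the `M ≡ 1` branch). -/
theorem square_case_nrm : ∀ z a : F9, ∀ f : ZMod 3, a ≠ 0 → f ≠ 0 → mul9 z (mul9 a a) = (f, 0) →
    nrm z = 1 ∧ (z.2 = 0 ↔ nrm a = 1) := by decide

/-- … and with the input `N(α₀) ≡ Nrd u = f (mod 3)` the type is read off `f mod 3` alone: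
`v' ≥ 9` at every prime over `3` iff `f ≡ 1 (mod 3)`, `v' = 6` at every prime iff `f ≡ 2 (mod 3)`. -/
theorem square_case_f : ∀ z a : F9, ∀ f : ZMod 3, a ≠ 0 → nrm a = f → mul9 z (mul9 a a) = (f, 0) →
    (z.2 = 0 ↔ f = 1) := by decide

/-- Integer side of the square case: `3 ∤ f` ⇒ `f mod 3 ∈ {1, 2}` and `M = f² ≡ 1 (mod 3)`
(so `D = -3f²` lies in the `M ≡ 1` branch). -/
theorem sq_mod_three_of_not_dvd (f : ℕ) (h : ¬ 3 ∣ f) :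
    (f % 3 = 1 ∨ f % 3 = 2) ∧ f ^ 2 % 3 = 1 := by
  refine ⟨by omega, ?_⟩
  rcases (show f % 3 = 1 ∨ f % 3 = 2 by omega) with h1 | h2
  · rw [Nat.pow_mod, h1]
  · rw [Nat.pow_mod, h2]

/-- Norms of `O_D`-ideals prime to `3` are `≡ x² (mod 3)` on the principal class when `3 ∣ D`:
the principal form `x² + D x y + (D² - D)/4 · y²` reduces to `x²` mod `3` (here with `D = 3 D'`,
`(D² - D)/4 = c`, `4 c = D² - D`).  Hence `χ₃ = (N · | 3)` is well defined on `Pic(O_D)`. -/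
theorem principal_norm_mod_three (D' c x y : ℤ) (hc : 4 * c = (3 * D') ^ 2 - 3 * D') :
    (x ^ 2 + 3 * D' * x * y + c * y ^ 2) % 3 = x ^ 2 % 3 := by
  have h3 : (3 : ℤ) ∣ c := by
    have : (3 : ℤ) ∣ 4 * c := ⟨3 * D' ^ 2 - D', by rw [hc]; ring⟩
    omega
  obtain ⟨c', rfl⟩ := h3
  have : x ^ 2 + 3 * D' * x * y + 3 * c' * y ^ 2 = x ^ 2 + 3 * (D' * x * y + c' * y ^ 2) := by ring
  rw [this]; omega

/-- Membership criterion behind `v' ≥ 9 ⟺ 3 ∣ b ∧ 3 ∣ d`: the pure quaternion `b i + d k` lies in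
`3 O`, `O = ℤ⟨1, i, (1+j)/2, (i+k)/2⟩`, iff `3 ∣ b` and `3 ∣ d`.  An element
`x₀ + x₁ i + x₂ (1+j)/2 + x₃ (i+k)/2` has doubled `(1, i, j, k)`-coordinates
`(2x₀ + x₂, 2x₁ + x₃, x₂, x₃)`. -/
theorem mem_three_O_iff (b d : ℤ) :
    (∃ x₀ x₁ x₂ x₃ : ℤ, (0 : ℤ) = 3 * (2 * x₀ + x₂) ∧ 2 * b = 3 * (2 * x₁ + x₃) ∧
        (0 : ℤ) = 3 * x₂ ∧ 2 * d = 3 * x₃) ↔ (3 ∣ b ∧ 3 ∣ d) := by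
  constructor
  · rintro ⟨x₀, x₁, x₂, x₃, h₀, h₁, h₂, h₃⟩
    omega
  · rintro ⟨⟨b', rfl⟩, ⟨d', rfl⟩⟩
    exact ⟨0, b' - d', 0, 2 * d', by ring, by ring, by ring, by ring⟩

/-- COUNT: a sign function on a finite group `G` that transforms by a character `χ` of order two,
`ε (a * g) = χ a * ε g`, takes the value of `ε 1` on exactly the kernel of `χ`; if `χ` is onto `{±1}`
the kernel has index `2`, so exactly half of `G` (here: of `Pic(O_D)`, acting simply transitively on the
CM classes) has each type.  We record the torsor identity and the index statement. -/
theorem torsor_values {G : Type*} [Group G] (χ : G →* ℤˣ) (ε : G → ℤˣ)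
    (hε : ∀ a g : G, ε (a * g) = χ a * ε g) (g : G) : ε g = χ g * ε 1 := by
  simpa using hε g 1

/-- The classes of the same type as the base class are exactly the kernel of `χ`. -/
theorem torsor_same_type_iff {G : Type*} [Group G] (χ : G →* ℤˣ) (ε : G → ℤˣ)
    (hε : ∀ a g : G, ε (a * g) = χ a * ε g) (g : G) : ε g = ε 1 ↔ g ∈ χ.ker := by
  rw [torsor_values χ ε hε g, MonoidHom.mem_ker]
  constructor
  · intro h
    simpa using h
  · intro h
    rw [h, one_mul]

/-- If `χ` is onto `ℤˣ = {±1}` its kernel has index `2`: half of the classes have each type. -/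
theorem index_ker_eq_two {G : Type*} [Group G] (χ : G →* ℤˣ) (hχ : Function.Surjective χ) :
    χ.ker.index = 2 := by
  rw [Subgroup.index_ker, MonoidHom.range_eq_top.mpr hχ]
  simp [Nat.card_eq_fintype_card]

end Summit.HodgeConjecture.HodgeConjecture.HodgeLocus.Census.ValJ0At3Genus
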